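import Literature.Geometry.Riemannian.RicciFlowScaling
import Literature.Geometry.Riemannian.RicciFlowScalarCurvature
import Literature.Geometry.Lorentzian.EnergyCurrents
import HarnessLib

/-!
# Metric contractions under constant rescaling `g ↦ c • g`
(topic `Geometry/Riemannian`)

Companion to `RicciFlowScaling.lean` (`PseudoRiemannianMetric.constSmul`: `(c • g)_b = c g_b`,
with the behaviour of compatibility, Levi-Civita connections, `Rm`, isotropic curvature and
orthonormal frames under `g ↦ c • g`). This file adds the index-raising side: under `g ↦ c • g`
the musical isomorphism `♯` and hence every metric contraction pick up a factor `c⁻¹` per raised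
index —
* `sharp_constSmul`: `♯_{c g} = c⁻¹ ♯_g`;
* `trace_constSmul`: `tr_{c g} T = c⁻¹ tr_g T`; `normSq_constSmul`: `|T|²_{c g} = c⁻² |T|²_g`;
* `innerDual_constSmul`: `(c g)⁻¹(α, β) = c⁻¹ g⁻¹(α, β)`; `gradSq_constSmul`:
  `|dψ|²_{c g} = c⁻¹ |dψ|²_g`;
* `scalarCurvatureWith_constSmul`: `R(c g, ∇) = c⁻¹ R(g, ∇)` for any connection `∇` (the Ricci
  tensor of `∇` does not see `g`; for the Levi-Civita connection, which `c • g` shares with `g`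
  (`IsLeviCivita.constSmul`), this is the scaling `R ↦ λ⁻¹ R` of Topping 2006, §1.2.3).
These are the pointwise identities behind every parabolic rescaling argument of the Ricci flow
with surgery (Chen–Zhu 2006, §§3–5: curvature thresholds `R ≥ r⁻²`, the gradient estimates
`|∇R| < η R^{3/2}`, `|∂R/∂t| < η R²`, and the canonical neighbourhood assumption are
scale-invariant), recorded here for the normalisation "we may assume `T₀ > 1`" (§5, p. 26;
`exists_isMaximalRicciFlow_one_lt_of_isMaximalRicciFlow`).

## References

* P. Topping, *Lectures on the Ricci flow*, LMS Lecture Note Series 325 (2006), §1.2.3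
  (1.2.7)–(1.2.8): under `g ↦ λ g`, `Ric ↦ Ric`, `R ↦ λ⁻¹ R`. [Topping2006]
* B. O'Neill, *Semi-Riemannian geometry* (1983), Ch. 3, pp. 60–61 (musical isomorphisms,
  metric contraction). [ONeill1983]
-/

noncomputable section

open Bundle Set
open scoped Manifold ContDiff Topology

namespace Literature.Geometry.Riemannian

open Literature.Geometry.Lorentzian (PseudoRiemannianMetric)
open Literature.Geometry.Lorentzian.PseudoRiemannianMetric

/-! ### On a vector bundle with finite-dimensional fibres -/

section Bundle

variable
  {EB : Type*} [NormedAddCommGroup EB] [NormedSpace ℝ EB]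
  {HB : Type*} [TopologicalSpace HB] {IB : ModelWithCorners ℝ EB HB} {n : ℕ∞ω}
  {B : Type*} [TopologicalSpace B] [ChartedSpace HB B]
  {F : Type*} [NormedAddCommGroup F] [NormedSpace ℝ F] [FiniteDimensional ℝ F]
  {E : B → Type*} [TopologicalSpace (TotalSpace F E)]
  [∀ b, TopologicalSpace (E b)] [∀ b, AddCommGroup (E b)] [∀ b, Module ℝ (E b)]
  [FiberBundle F E] [VectorBundle ℝ F E]

/-- **Index raising under rescaling**: `♯_{c g} α = c⁻¹ ♯_g α` (from `(c g)_b(c⁻¹ ♯α, w) = α w`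
and injectivity of `♭_{c g}`). [cite: ONeill1983, Ch. 3, p. 60] -/
theorem _root_.Literature.Geometry.Lorentzian.PseudoRiemannianMetric.sharp_constSmul
    (g : PseudoRiemannianMetric IB n F E) (c : ℝ) (hc : c ≠ 0) (b : B) (α : Module.Dual ℝ (E b)) :
    (g.constSmul c hc).sharp b α = c⁻¹ • g.sharp b α := by
  apply (g.constSmul c hc).flat_injective b
  rw [flat_sharp, map_smul]
  apply LinearMap.ext
  intro w
  rw [LinearMap.smul_apply, flat_apply, constSmul_apply, val_sharp_apply, smul_eq_mul,
    inv_mul_cancel_left₀ hc]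

/-- **Metric trace under rescaling**: `tr_{c g} T = c⁻¹ tr_g T` (`g^{ij} ↦ c⁻¹ g^{ij}`).
[cite: ONeill1983, Ch. 3, pp. 60–61] -/
theorem _root_.Literature.Geometry.Lorentzian.PseudoRiemannianMetric.trace_constSmul
    (g : PseudoRiemannianMetric IB n F E) (c : ℝ) (hc : c ≠ 0) (b : B)
    (T : LinearMap.BilinForm ℝ (E b)) :
    (g.constSmul c hc).trace b T = c⁻¹ * g.trace b T := by
  have key : ((g.constSmul c hc).sharp b).toLinearMap ∘ₗ T =
      c⁻¹ • ((g.sharp b).toLinearMap ∘ₗ T) := by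
    apply LinearMap.ext
    intro v
    simp [sharp_constSmul]
  rw [PseudoRiemannianMetric.trace, PseudoRiemannianMetric.trace, key, LinearMap.map_smul,
    smul_eq_mul]

/-- **Metric square norm under rescaling**: `|T|²_{c g} = c⁻² |T|²_g` (two raised indices).
[cite: ONeill1983, Ch. 3, pp. 60–61] -/
theorem _root_.Literature.Geometry.Lorentzian.PseudoRiemannianMetric.normSq_constSmul
    (g : PseudoRiemannianMetric IB n F E) (c : ℝ) (hc : c ≠ 0) (b : B)
    (T : LinearMap.BilinForm ℝ (E b)) :
    (g.constSmul c hc).normSq b T = c⁻¹ ^ 2 * g.normSq b T := by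
  have key : ∀ S : LinearMap.BilinForm ℝ (E b), ((g.constSmul c hc).sharp b).toLinearMap ∘ₗ S =
      c⁻¹ • ((g.sharp b).toLinearMap ∘ₗ S) := by
    intro S
    apply LinearMap.ext
    intro v
    simp [sharp_constSmul]
  rw [PseudoRiemannianMetric.normSq, PseudoRiemannianMetric.normSq, key, key,
    LinearMap.smul_comp, LinearMap.comp_smul, smul_smul, LinearMap.map_smul, smul_eq_mul, sq]

/-- **Inverse metric under rescaling**: `(c g)⁻¹(α, β) = c⁻¹ g⁻¹(α, β)`.
[cite: ONeill1983, Ch. 3, p. 60] -/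
theorem _root_.Literature.Geometry.Lorentzian.PseudoRiemannianMetric.innerDual_constSmul
    (g : PseudoRiemannianMetric IB n F E) (c : ℝ) (hc : c ≠ 0) (b : B)
    (α β : Module.Dual ℝ (E b)) :
    (g.constSmul c hc).innerDual b α β = c⁻¹ * g.innerDual b α β := by
  rw [PseudoRiemannianMetric.innerDual, PseudoRiemannianMetric.innerDual, sharp_constSmul,
    map_smul, smul_eq_mul]

end Bundle

/-! ### On the tangent bundle: gradient square and scalar curvature -/

section Tangent

variable {E : Type*} [NormedAddCommGroup E] [NormedSpace ℝ E] {H : Type*} [TopologicalSpace H]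
  {I : ModelWithCorners ℝ E H} {M : Type*} [TopologicalSpace M] [ChartedSpace H M]
  [IsManifold I ∞ M] {n : ℕ∞ω} [FiniteDimensional ℝ E]

/-- **Gradient square under rescaling**: `|dψ|²_{c g} = c⁻¹ |dψ|²_g` — so that, with
`R(c g) = c⁻¹ R(g)`, the quotient `|∇R|² / R³` of the gradient estimate `|∇R| < η R^{3/2}` is
scale-invariant. [folklore] -/
theorem _root_.Literature.Geometry.Lorentzian.PseudoRiemannianMetric.gradSq_constSmul
    (g : PseudoRiemannianMetric I n E (TangentSpace I : M → Type _)) (c : ℝ) (hc : c ≠ 0)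
    (ψ : M → ℝ) (x : M) :
    (g.constSmul c hc).gradSq ψ x = c⁻¹ * g.gradSq ψ x :=
  innerDual_constSmul g c hc x _ _

/-- **Scalar curvature under rescaling**: `R(c g, ∇) = tr_{c g} Ric(∇) = c⁻¹ R(g, ∇)` for every
connection `∇` — Topping's `R ↦ λ⁻¹ R` under `g ↦ λ g` (the Levi-Civita connection, and with it
`Ric`, being unchanged: `IsLeviCivita.constSmul`). [cite: Topping2006, §1.2.3, (1.2.8)] -/
theorem _root_.Literature.Geometry.Lorentzian.PseudoRiemannianMetric.scalarCurvatureWith_constSmul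
    (g : PseudoRiemannianMetric I n E (TangentSpace I : M → Type _)) (c : ℝ) (hc : c ≠ 0)
    (cov : CovariantDerivative I E (TangentSpace I : M → Type _)) (x : M) :
    (g.constSmul c hc).scalarCurvatureWith cov x = c⁻¹ * g.scalarCurvatureWith cov x :=
  trace_constSmul g c hc x _

/-- The curvature threshold is scale-covariant: `R(c g) ≥ ρ⁻²` iff `R(g) ≥ (√c ρ)⁻²`… in the form
used for the canonical neighbourhood parameter, `r⁻² ≤ R(g, ∇)(x) ↔ (c r²)⁻¹ ≤ R(c g, ∇)(x)` for
`c > 0`. [folklore] -/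
theorem _root_.Literature.Geometry.Lorentzian.PseudoRiemannianMetric.le_scalarCurvatureWith_constSmul_iff
    (g : PseudoRiemannianMetric I n E (TangentSpace I : M → Type _)) {c : ℝ} (hc : 0 < c)
    (cov : CovariantDerivative I E (TangentSpace I : M → Type _)) (x : M) (a : ℝ) :
    c⁻¹ * a ≤ (g.constSmul c hc.ne').scalarCurvatureWith cov x ↔ a ≤ g.scalarCurvatureWith cov x := by
  rw [scalarCurvatureWith_constSmul]
  constructor
  · intro h
    have h' := mul_le_mul_of_nonneg_left h hc.le
    rwa [mul_inv_cancel_left₀ hc.ne', mul_inv_cancel_left₀ hc.ne'] at h'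
  · intro h
    exact mul_le_mul_of_nonneg_left h (inv_nonneg.mpr hc.le)

end Tangent

end Literature.Geometry.Riemannian

end
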